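import Mathlib
import Summits.Ventures.HodgeRepro.Tier4.Common.KTypeSpace
import Summits.Ventures.HodgeRepro.Tier4.Common.SettingOfData
import Summits.Ventures.HodgeRepro.Tier4.Line1.SpectralOfRTF
import Summits.Ventures.HodgeRepro.Tier4.Line4.W4SpectralBridge
import Summits.Ventures.HodgeRepro.Tier4.Line4.W3Reduction
import Summits.Ventures.HodgeRepro.Tier4.Line4.W3Reduction2

/-!
# Tier4/Line4/W3ReductionGeneric — L1-p5's repaired reduction of the L4 wall, GENERIC in the space that carries the
Riesz vector (the joint `kTypeSpace` as landed, or a one-torus Riesz space after F-L4-JOINT)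

Blind re-derivation cell `pub-hodge-repro`, Tier 4 «prove the step» (README §9–§10), seat t4-L4-p1 (prover, LINE L4,
gen 3; F-L4-JOINT = L4-p2 g3 S13737 / S13756).  Tree path `lean/Summits/Ventures/HodgeRepro/Tier4/Line4/W3ReductionGeneric.lean`.

WHAT IS PROVED.  `mixed_two_torus_W3_of_spectral_data_generic`: for ANY assignment `Sp : Subgroup (GA W) → Submodule →
Submodule` of a «Riesz space at the level `K`» to a constituent, the reduction of L1-p5's
`W3Reduction2.mixed_two_torus_W3_of_spectral_data''` (p681726) holds with `kTypeSpace … K V` replaced by `Sp K V` in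
the block clause `hspan` and in the conclusion — the proof (`exists_specBlock_ne_zero` → `specBlock_eq` →
`block_eq_periodT_rieszOf` → `isRieszVectorOn_rieszOf`, all L1-p5 / L1-p1 by name) never uses what the space is.
Instances: `Sp := kTypeSpace W q g g' eP eM eP' eM' K` recovers `…_data''`; a one-torus Riesz space (`T′`-weight
`K`-fixed vectors, or `T`-weight ones) is the repair of F-L4-JOINT (O-L4-JOINT, crit-1 g5 S13773), to be chosen by
the planner / typer and instantiated here in one line.  Nothing of the wall's content is proved.

Nothing here says anything about the status of the Hodge conjecture for CM abelian varieties, which is NOT proved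
(HC_CM is NOT proved by anyone in this repository).
-/

set_option autoImplicit false

noncomputable section

namespace Summit.Ventures.HodgeRepro.Tier4.Line4

open Summit.Ventures.HodgeRepro.Tier4.Common Summit.Ventures.HodgeRepro.Tier4.Line1 MeasureTheory NumberField
open scoped ComplexConjugate

section Generic

variable {k : Type} [Field k] [NumberField k] (W : PlaneData k) [MeasurableSpace (GA W)] [BorelSpace (GA W)]
  (R : RTFData W) (μ : Measure (GA W)) [μ.IsHaarMeasure] [R.μT.IsHaarMeasure] [R.μT'.IsHaarMeasure]
  (DG : Set (GA W)) (fdG : IsFundamentalDomain (rationalPoints W) DG μ) (compG : IsCompact (closure DG))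
  (compT : IsCompact (closure R.DT)) (compT' : IsCompact (closure R.DT'))

/-- **W3″-type conclusion from displayed spectral data, GENERIC in the Riesz space** (`Sp K V` = the subspace of `V`
carrying the Riesz vector at the level `K`: typer-2's joint `kTypeSpace` as landed, or a one-torus Riesz space after
F-L4-JOINT; the proof never uses what `Sp` is): L1-p5's `W3Reduction2.mixed_two_torus_W3_of_spectral_data''` (p681726)
verbatim with `kTypeSpace … K V` replaced by `Sp K V` in `hspan` and in the conclusion.  Proof = L1-p5's, by name. -/
theorem mixed_two_torus_W3_of_spectral_data_generic (Sp : Subgroup (GA W) → Submodule ℂ (GA W → ℂ) → Submodule ℂ (GA W → ℂ))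
    (hc : Continuous R.chi) (hu : ∀ a, ‖R.chi a‖ = 1)
    (hc' : Continuous R.chi') (hunit' : ∀ t, ‖R.chi' t‖ = 1)
    (q : QuadData k) (g g' : Matrix (Fin 4) (Fin 4) k) (w₀ : InfinitePlace k)
    (eP eM eP' eM' : InfinitePlace k → ℤ) (V : ℕ → Submodule ℂ (GA W → ℂ))
    (K : Subgroup (GA W)) (hK : IsCompactOpenIn W (finitePart W) K)
    {τ : ℕ → Set (GA W → ℂ)} {φ : ℕ → GA W → ℂ} {n : ℕ → ℕ}
    (hB : (Setting.ofAdelicData W R μ DG fdG compG compT compT').IsAdaptedONB τ φ n)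
    (F : ℕ → Finset ℕ) (hF : ∀ m, ∀ j ∈ F m, n j = m)
    (hspan : ∀ m, Submodule.span ℂ ((fun j => fun x => conj (φ j x)) '' (F m : Set ℕ)) =
      Sp K (V m))
    {f₁ f₂ : GA W → ℂ} (h₁ : IsTestFn W f₁) (h₂ : IsTestFn W f₂) (a b : ℕ → ℂ)
    (hadm : ∀ m, a m ≠ 0 →
      IsAdmissibleS W (Setting.ofAdelicData W R μ DG fdG compG compT compT') q g g' w₀ eP eM eP' eM' (V m))
    (ha : ∀ m, ∀ j ∈ F m, rightRegular W μ (RTF.cj f₁) (φ j) = fun x => a m * φ j x)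
    (hb : ∀ m, ∀ j ∈ F m, rightRegular W μ (RTF.refl f₂) (φ j) = fun x => b m * φ j x)
    (hvan' : ∀ j, j ∉ F (n j) → rightRegular W μ (RTF.cj f₁) (φ j) = fun _ => 0)
    (hJ : R.Jc ((Setting.ofAdelicData W R μ DG fdG compG compT compT').conv f₁ f₂) ≠ 0) :
    ∃ V₀ : Submodule ℂ (GA W → ℂ),
      IsAdmissibleS W (Setting.ofAdelicData W R μ DG fdG compG compT compT') q g g' w₀ eP eM eP' eM' V₀ ∧
      ∃ K₀ : Subgroup (GA W), IsCompactOpenIn W (finitePart W) K₀ ∧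
        FiniteDimensional ℂ (Sp K₀ V₀) ∧
        ∃ f : GA W → ℂ, IsRieszVectorOn R μ DG (Sp K₀ V₀) f ∧
          periodLin W R.μT R.DT R.chi (restrictTo W (torusT W) f) ≠ 0 := by
  set S := Setting.ofAdelicData W R μ DG fdG compG compT compT' with hS
  haveI := t2Space_GA W
  have h₁' : RTF.IsTest f₁ := ⟨h₁.1, h₁.2⟩
  have h₂' : RTF.IsTest f₂ := ⟨h₂.1, h₂.2⟩
  have hconv : IsTestFn W (S.conv f₁ f₂) :=
    ⟨(S.conv_isTest h₁' h₂').1.cont, (S.conv_isTest h₁' h₂').1.compact⟩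
  have hJ' : S.J R.chi R.chi' (S.conv f₁ f₂) ≠ 0 := by
    rw [← Jc_eq_J W R μ DG fdG compG compT compT' hc hc' hconv]
    exact hJ
  obtain ⟨m, hm⟩ := S.exists_specBlock_ne_zero R.chi R.chi' φ n f₁ f₂
    (isCharacter_chi W R μ DG fdG compG compT compT' hc hu)
    (isCharacter'_chi' W R μ DG fdG compG compT compT' hc' hunit') hB h₁' h₂' hJ'
  rw [specBlock_eq W R μ DG fdG compG compT compT' hc hc' hB F hF a b ha hb hvan' m] at hm
  have ha0 : a m ≠ 0 := by
    intro h0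
    apply hm
    rw [h0, map_zero, mul_zero, zero_mul]
  have hP : R.periodT (restrictTo W (torusT W)
      (RTF.Setting.rieszOf (F m) (fun l x => conj (φ l x)) (periodT'Fun W R))) ≠ 0 :=
    (mul_ne_zero_iff.mp hm).2
  have hne := exists_period_ne_zero_of_rieszOf_period_ne_zero W R (F m) φ hP
  refine ⟨V m, hadm m ha0, K, hK, ?_, RTF.Setting.rieszOf (F m) (fun l x => conj (φ l x)) (periodT'Fun W R),
    ?_, ?_⟩
  · rw [← hspan m]
    exact FiniteDimensional.span_of_finite ℂ ((F m).finite_toSet.image _)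
  · exact isRieszVectorOn_rieszOf W R μ DG fdG compG compT compT' hB (F m) _ (hspan m).symm hne
  · exact hP

end Generic

end Summit.Ventures.HodgeRepro.Tier4.Line4

end
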